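import Literature.NumberTheory.Automorphic.AdmissibleSubquotient     -- ★ `Representation.map_mem_fixedPoints`, `IsAdmissible.of_surjective` (sub ∕ quotient halves)
import Literature.NumberTheory.Automorphic.FixedVectorsRankAdditive  -- ★ p852923 `Representation.mem_fixedPoints_of_map_mem` (left exactness of `V ↦ V^K`, reused)
import Mathlib.RingTheory.Finiteness.Finsupp                        -- `Module.Finite.of_exact`
import Mathlib.Topology.Algebra.Group.Compact
import Mathlib.GroupTheory.Index
import HarnessLib

/-!
# Smooth extensions: the middle term of `0 → ρ₁ → ρ₂ → ρ₃ → 0` is admissible, and has the common central character when `Z(G)` is compact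

Topic `NumberTheory/Automorphic`; namespace `Representation` (dot-lemmas on Mathlib's `Representation`, as in the sibling files
`SmoothRepresentation`, `AdmissibleSubquotient`).  THEOREMS ONLY (no definition, no named fact, no instance, no notation, no `sorry`).
Cell `hodgecm-mathlib`, E1 row 71 «(S1) CASSELMAN'S CRITERION IN RANK ONE» (census `CENSUS-S1-CasselmanRankOne.v1`, bricks (G2) + (G3));
seat «LH6» LH6-p04 (g12).  Generic in the group `G` and the field `k`; written for the K2′-`L²` road (every smooth self-extension `τ` of an
irreducible admissible `L²` class is admissible with the same unitary central character, so that Casselman's criterion ★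
`UnitaryGroup.U3SquareIntegrableExponents` applies to `τ`).

RESULTS.  For intertwining maps `f : ρ₁ → ρ₂`, `g : ρ₂ → ρ₃` with `Function.Exact f g`:
* §1 **`IsAdmissible.of_exact`** (left exactness of `K`-fixed vectors = ★ `mem_fixedPoints_of_map_mem`, `FixedVectorsRankAdditive`) — if `ρ₁`, `ρ₃` are admissible, `ρ₂` is smooth and `f` is injective, then `ρ₂` is admissible:
  `0 → V₁^K → V₂^K → V₃^K` is exact, so `V₂^K` is finite-dimensional (`Module.Finite.of_exact` on the range-restricted map).
  [BernsteinZelevinsky1976 §2.1; Casselman1995 §2.1] (pure linear algebra).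
* §2 `exists_pow_mem_of_isOpen_of_isCompact_center` — a compact centre meets every open subgroup with finite index: `z ∈ Z(G)`, `S` open
  ⇒ `z ^ m ∈ S` for some `m ≥ 1`;
  **`forall_apply_eq_smul_of_exact_of_isCompact_center`** — if `Z(G)` is compact, `ρ₂` is smooth, `k` has characteristic zero and the
  centre acts on `ρ₁` and on `ρ₃` through the SAME character `ω`, then it acts on `ρ₂` through `ω`.  Proof: for `z ∈ Z(G)` and `x ∈ V₂` put
  `c = ω z`, `y = ρ₂ z x − c • x`; exactness gives `y ∈ f(V₁)`, hence `ρ₂ z y = c • y`, and by induction `ρ₂ (z^(j+1)) x = c^(j+1) • x + ((j+1) c^j) • y`;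
  smoothness + compactness give `m, n ≥ 1` with `ρ₂ (z^m) y = y` (so `y = 0` or `c^m = 1`) and `ρ₂ (z^n) x = x`; at `N = n m` this reads
  `x = x + (N c^(N−1)) • y`, so `y = 0` in characteristic zero.  (No injectivity of `f`, no surjectivity of `g` needed.)

## References
* [BernsteinZelevinsky1976] I. N. Bernstein, A. V. Zelevinsky, *Representations of the group GL(n, F) where F is a non-archimedean local field*,
  Russian Math. Surveys 31:3 (1976): §2.1 (admissible representations), §2.10–2.11 (central character ∕ Schur).
* [Casselman1995] W. Casselman, *Introduction to the theory of admissible representations of `p`-adic reductive groups* (draft 1 May 1995): §2.1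
  (admissibility is inherited by subquotients and extensions), §2.5 p. 28 (`ω`-representations).
-/

set_option autoImplicit false

namespace Representation

/-! ## §1 Admissibility of the middle term -/

section Admissible

variable {k G : Type*} [Field k] [Group G] [TopologicalSpace G]
  {V₁ V₂ V₃ : Type*} [AddCommGroup V₁] [Module k V₁] [AddCommGroup V₂] [Module k V₂] [AddCommGroup V₃] [Module k V₃]
  {ρ₁ : Representation k G V₁} {ρ₂ : Representation k G V₂} {ρ₃ : Representation k G V₃}

/-- **The middle term of an exact sequence `ρ₁ →f ρ₂ →g ρ₃` (`f` injective, exact at `ρ₂`) of representations with `ρ₁`, `ρ₃` ADMISSIBLE and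
`ρ₂` SMOOTH is admissible**: for every compact open `K`, `0 → V₁^K → V₂^K → V₃^K` is exact, so `V₂^K` is finite-dimensional.
(Surjectivity of `g` is not needed: the range of `V₂^K → V₃^K` is a subspace of the finite-dimensional `V₃^K`.)
[cite: BernsteinZelevinsky1976, §2.1] [cite: Casselman1995, §2.1] -/
theorem IsAdmissible.of_exact (h₁ : ρ₁.IsAdmissible) (h₃ : ρ₃.IsAdmissible) (h₂ : ρ₂.IsSmooth)
    (f : ρ₁.IntertwiningMap ρ₂) (g : ρ₂.IntertwiningMap ρ₃) (hf : Function.Injective f) (hfg : Function.Exact f g) :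
    ρ₂.IsAdmissible := by
  refine ⟨h₂, fun K hK => ?_⟩
  haveI : Module.Finite k (ρ₁.fixedPoints (K : Subgroup G)) := h₁.2 K hK
  haveI : Module.Finite k (ρ₃.fixedPoints (K : Subgroup G)) := h₃.2 K hK
  -- the restricted maps `V₁^K → V₂^K → V₃^K`
  let f' : ρ₁.fixedPoints (K : Subgroup G) →ₗ[k] ρ₂.fixedPoints (K : Subgroup G) :=
    f.toLinearMap.restrict fun v hv => map_mem_fixedPoints f (K : Subgroup G) hv
  let g' : ρ₂.fixedPoints (K : Subgroup G) →ₗ[k] ρ₃.fixedPoints (K : Subgroup G) :=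
    g.toLinearMap.restrict fun v hv => map_mem_fixedPoints g (K : Subgroup G) hv
  haveI : Module.Finite k (LinearMap.range g') :=
    Module.Finite.of_injective (LinearMap.range g').subtype Subtype.val_injective
  refine Module.Finite.of_exact (f := f') (g := g'.rangeRestrict) (fun v => ⟨fun hv => ?_, ?_⟩) g'.surjective_rangeRestrict
  · -- `g v = 0`, so `v = f w` with `w ∈ V₁^K` by left exactness
    have hgv : g (v : V₂) = 0 := by
      have h := congrArg (fun x : LinearMap.range g' => ((x : ρ₃.fixedPoints (K : Subgroup G)) : V₃)) hv
      simpa [g', LinearMap.codRestrict_apply] using h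
    obtain ⟨w, hw⟩ := (hfg (v : V₂)).1 hgv
    refine ⟨⟨w, mem_fixedPoints_of_map_mem f hf (K : Subgroup G) (hw ▸ v.2)⟩, ?_⟩
    ext
    simpa [f'] using hw
  · rintro ⟨w, rfl⟩
    have h0 : g (f (w : V₁)) = 0 := (hfg (f (w : V₁))).2 ⟨w, rfl⟩
    ext
    simpa [f', g', LinearMap.codRestrict_apply] using h0

end Admissible

/-! ## §2 The central character of the middle term when the centre is compact -/

section Central

variable {k G : Type*} [Field k] [CharZero k] [Group G] [TopologicalSpace G] [IsTopologicalGroup G]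
  {V₁ V₂ V₃ : Type*} [AddCommGroup V₁] [Module k V₁] [AddCommGroup V₂] [Module k V₂] [AddCommGroup V₃] [Module k V₃]
  {ρ₁ : Representation k G V₁} {ρ₂ : Representation k G V₂} {ρ₃ : Representation k G V₃}

omit [CharZero k] in
/-- **A compact centre meets every open subgroup with finite index**: for `z ∈ Z(G)` compact and `S ≤ G` open there is `m ≥ 1` with `z ^ m ∈ S`
(the quotient of the compact group `Z(G)` by the open subgroup `S ∩ Z(G)` is compact and discrete, hence finite; pigeonhole on the cosets of
the powers of `z`). [cite: BernsteinZelevinsky1976, §2.10] -/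
theorem exists_pow_mem_of_isOpen_of_isCompact_center (hZ : IsCompact ((Subgroup.center G : Subgroup G) : Set G))
    (S : Subgroup G) (hS : IsOpen (S : Set G)) (z : Subgroup.center G) : ∃ m : ℕ, 0 < m ∧ (z : G) ^ m ∈ S := by
  haveI : CompactSpace (Subgroup.center G) := isCompact_iff_compactSpace.1 hZ
  let S' : Subgroup (Subgroup.center G) := S.comap (Subgroup.center G).subtype
  have hS' : IsOpen (S' : Set (Subgroup.center G)) := hS.preimage continuous_subtype_val
  haveI : DiscreteTopology ((Subgroup.center G) ⧸ S') := QuotientGroup.discreteTopology_iff.mpr hS'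
  haveI : Finite ((Subgroup.center G) ⧸ S') := finite_of_compact_of_discrete
  haveI : S'.FiniteIndex := Subgroup.finiteIndex_of_finite_quotient
  obtain ⟨m, hm, -, hmem⟩ := S'.exists_pow_mem_of_index_ne_zero S'.index_ne_zero_of_finite z
  refine ⟨m, hm, ?_⟩
  have h := Subgroup.mem_comap.1 hmem
  simpa using h

omit [TopologicalSpace G] [IsTopologicalGroup G] in
/-- The iterate formula behind the central-character lemma: if `ρ z y = c • y` and `ρ z x = c • x + y`, then
`ρ (z ^ (j + 1)) x = c ^ (j + 1) • x + ((j + 1) * c ^ j) • y` for every `j`. [cite: BernsteinZelevinsky1976, §2.10] -/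
theorem apply_pow_succ_eq_of_apply_eq_smul_add (ρ : Representation k G V₂) (z : G) (c : k) (x y : V₂)
    (hx : ρ z x = c • x + y) (hy : ρ z y = c • y) (j : ℕ) :
    ρ (z ^ (j + 1)) x = c ^ (j + 1) • x + (((j : k) + 1) * c ^ j) • y := by
  induction j with
  | zero => simp [hx]
  | succ j ih =>
    rw [pow_succ', map_mul, Module.End.mul_apply, ih, map_add, map_smul, map_smul, hx, hy]
    simp only [smul_add, smul_smul, Nat.cast_succ]
    rw [add_assoc, ← add_smul, show c ^ (j + 1) * c = c ^ (j + 1 + 1) by ring,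
      show c ^ (j + 1) + ((j : k) + 1) * c ^ j * c = ((j : k) + 1 + 1) * c ^ (j + 1) by ring]

/-- **The middle term of `ρ₁ →f ρ₂ →g ρ₃` (exact at `ρ₂`) is an `ω`-representation when `ρ₁`, `ρ₃` are and `Z(G)` is COMPACT** (`ρ₂` smooth,
characteristic zero): for `z ∈ Z(G)`, `x ∈ V₂`, `c = ω z` and `y = ρ₂ z x − c • x`, exactness puts `y` in `f(V₁)` (as `g y = 0`), so `ρ₂ z y = c • y`;
smoothness and compactness give `m, n ≥ 1` with `ρ₂ (z^m) y = y` — whence `y = 0` or `c ^ m = 1` — and `ρ₂ (z^n) x = x`; the iterate formula at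
`N = n·m` gives `x = x + (N c^{N-1}) • y`, so `y = 0`.  Neither injectivity of `f` nor surjectivity of `g` is used.  (For a NON-compact centre the
statement fails: `ℤ` acting on `k²` by unipotent matrices extends the trivial character by itself.)
[cite: Casselman1995, §2.5 p. 28] [cite: BernsteinZelevinsky1976, §2.10] -/
theorem forall_apply_eq_smul_of_exact_of_isCompact_center (hZ : IsCompact ((Subgroup.center G : Subgroup G) : Set G))
    (h₂ : ρ₂.IsSmooth) (f : ρ₁.IntertwiningMap ρ₂) (g : ρ₂.IntertwiningMap ρ₃) (hfg : Function.Exact f g)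
    (ω : Subgroup.center G →* kˣ)
    (hω₁ : ∀ (z : Subgroup.center G) (x : V₁), ρ₁ (z : G) x = ((ω z : kˣ) : k) • x)
    (hω₃ : ∀ (z : Subgroup.center G) (x : V₃), ρ₃ (z : G) x = ((ω z : kˣ) : k) • x) :
    ∀ (z : Subgroup.center G) (x : V₂), ρ₂ (z : G) x = ((ω z : kˣ) : k) • x := by
  intro z x
  set c : k := ((ω z : kˣ) : k) with hc
  have hc0 : c ≠ 0 := (ω z).ne_zero
  set y : V₂ := ρ₂ (z : G) x - c • x with hy
  have hx : ρ₂ (z : G) x = c • x + y := by rw [hy]; abel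
  -- `g y = 0`, so `y = f s` and `ρ₂ z y = c • y`
  have hgy : g y = 0 := by
    rw [hy, map_sub, map_smul, g.isIntertwining, hω₃ z (g x), ← hc, sub_self]
  obtain ⟨s, hs⟩ := (hfg y).1 hgy
  have hzy : ρ₂ (z : G) y = c • y := by
    rw [← hs, ← f.isIntertwining, hω₁ z s, map_smul]
  -- powers of `z` act on `y` by powers of `c`
  have hpow_y : ∀ j : ℕ, ρ₂ ((z : G) ^ j) y = c ^ j • y := by
    intro j
    induction j with
    | zero => simp
    | succ j ih => rw [pow_succ', map_mul, Module.End.mul_apply, ih, map_smul, hzy, smul_smul, ← pow_succ]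
  -- a power of `z` fixing `y`: either `y = 0` (done) or `c ^ m = 1`
  obtain ⟨m, hm, hmS⟩ := exists_pow_mem_of_isOpen_of_isCompact_center hZ (ρ₂.stabilizerSubgroup y) (h₂ y) z
  have hmy : ρ₂ ((z : G) ^ m) y = y := (ρ₂.mem_stabilizerSubgroup y _).1 hmS
  rw [hpow_y m] at hmy
  by_cases hy0 : y = 0
  · rw [hx, hy0, add_zero]
  have hcm : c ^ m = 1 := by
    have h1 : (c ^ m - 1) • y = 0 := by rw [sub_smul, one_smul, hmy, sub_self]
    rcases smul_eq_zero.1 h1 with h | h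
    · exact sub_eq_zero.1 h
    · exact absurd h hy0
  -- a power of `z` fixing `x`
  obtain ⟨n, hn, hnS⟩ := exists_pow_mem_of_isOpen_of_isCompact_center hZ (ρ₂.stabilizerSubgroup x) (h₂ x) z
  have hnx : ρ₂ ((z : G) ^ n) x = x := (ρ₂.mem_stabilizerSubgroup x _).1 hnS
  -- at `N = n * m`: `z^N` fixes `x` and `c^N = 1`
  obtain ⟨N, hN⟩ : ∃ N : ℕ, n * m = N + 1 := ⟨n * m - 1, (Nat.succ_pred_eq_of_pos (Nat.mul_pos hn hm)).symm⟩
  have hNx : ρ₂ ((z : G) ^ (N + 1)) x = x := by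
    rw [← hN, pow_mul, map_pow]
    -- `(ρ₂ (z^n))^m x = x`
    have : ∀ i : ℕ, (ρ₂ ((z : G) ^ n) ^ i) x = x := by
      intro i
      induction i with
      | zero => simp
      | succ i ih => rw [pow_succ, Module.End.mul_apply, hnx, ih]
    exact this m
  have hcN : c ^ (N + 1) = 1 := by rw [← hN, mul_comm, pow_mul, hcm, one_pow]
  have hiter := apply_pow_succ_eq_of_apply_eq_smul_add ρ₂ (z : G) c x y hx hzy N
  rw [hNx, hcN, one_smul] at hiter
  -- `x = x + ((N+1) c^N) • y` ⇒ `y = 0`, contradiction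
  have h0 : (((N : k) + 1) * c ^ N) • y = 0 := by
    have := congrArg (fun v => v - x) hiter
    simpa using this.symm
  rcases smul_eq_zero.1 h0 with h | h
  · rcases mul_eq_zero.1 h with h' | h'
    · exact absurd h' (by exact_mod_cast Nat.succ_ne_zero N)
    · exact absurd h' (pow_ne_zero N hc0)
  · exact absurd h hy0

end Central

end Representation
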